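import Summits.CriticalPhenomena.CardyFormulaZ2.Theorems.CardyWhiteToColouredSimilarityUpgradeStubRectangleDualityPart1

/-!
# Rectangle duality for bond-ℤ² crossing limits, part 3: rim sides in the arcs, lattice paths

Support file for stub `stub_rectangleDuality` (stub D) of line `registered` of crux
`SimilarityUpgrade` (stmt-CriticalPhenomena-4597, route `CardyWhiteToColoured`, sub-problem
`CardyFormulaZ2`): for full bond-ℤ² crossing limits `Φ`, `Φ (Q w₀) + Φ (Q' w₀) = 1` for the
left–right and bottom–top marked boxes `(0, w₀) × (0, 1)`.

Continuing part 1 (the box `Ioo 0 w ×ℂ Ioo 0 1` at a mesh `δ` with `δ (b + 2) = 1`,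
`δ (a + 1) < w ≤ δ (a + 2)`):

* a point of the frontier off one side is at least as far as the nearest other side
  (`le_dist_of_mem_frontier_diff_left` etc.), so the extreme columns lie in the discrete arcs of
  the left/right sides (`left_col_mem_arc`, `right_col_mem_arc`) and the extreme rows minus their
  last site in those of the bottom/top sides (`bottom_row_mem_arc`, `top_row_mem_arc`);
* open paths of `Ω_δ` are open lattice paths in the lattice box and conversely
  (`openConnIn_of_reachable`, `reachable_of_openConnIn`);
* the lattice box and its sides are the translates by `(1, 1)` of the tree's `rectangle a b` and
  its sides (`mem_shift_rectangle`, …, `shift_rectangle_eq_meshVertices`).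

No definitions are introduced.
-/

noncomputable section

namespace Summit.CriticalPhenomena.CardyFormulaZ2.Cruxes.SimilarityUpgrade.Stubs

open Set Metric Complex MeasureTheory Filter Topology
open Literature.Probability.LatticeModels Literature.Probability.Percolation
open Literature.Probability.RandomPlanarGeometry (ConformalRectangle)

variable {w δ : ℝ}

namespace RectangleDuality

/-! ## Distances from a point of the box to the frontier minus one side -/

/-- Distance from a point of the box to a frontier point off the LEFT side. [folklore] -/
theorem le_dist_of_mem_frontier_diff_left (hw : 0 < w) {p q : ℂ}
    (hq : q ∈ frontier (Ioo (0 : ℝ) w ×ℂ Ioo (0 : ℝ) 1) \ {z : ℂ | z.re = 0 ∧ z.im ∈ Icc (0 : ℝ) 1}) :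
    min (min p.im (1 - p.im)) (w - p.re) ≤ dist p q := by
  obtain ⟨hq, hqA⟩ := hq
  have hre := abs_re_sub_le_dist p q
  have him : |p.im - q.im| ≤ dist p q := by rw [dist_eq_norm, ← sub_im]; exact abs_im_le_norm _
  rcases (mem_frontier_box hw).1 hq with ⟨-, h | h⟩ | ⟨h | h, h'⟩
  · rw [h, sub_zero] at him
    exact (min_le_left _ _).trans ((min_le_left _ _).trans ((le_abs_self _).trans him))
  · rw [h] at him
    refine (min_le_left _ _).trans ((min_le_right _ _).trans (le_trans ?_ him))
    rw [abs_sub_comm]; exact le_abs_self _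
  · exact absurd ⟨h, h'⟩ hqA
  · rw [h] at hre
    refine (min_le_right _ _).trans (le_trans ?_ hre)
    rw [abs_sub_comm]; exact le_abs_self _

/-- Distance from a point of the box to a frontier point off the RIGHT side. [folklore] -/
theorem le_dist_of_mem_frontier_diff_right (hw : 0 < w) {p q : ℂ}
    (hq : q ∈ frontier (Ioo (0 : ℝ) w ×ℂ Ioo (0 : ℝ) 1) \ {z : ℂ | z.re = w ∧ z.im ∈ Icc (0 : ℝ) 1}) :
    min (min p.im (1 - p.im)) p.re ≤ dist p q := by
  obtain ⟨hq, hqA⟩ := hq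
  have hre := abs_re_sub_le_dist p q
  have him : |p.im - q.im| ≤ dist p q := by rw [dist_eq_norm, ← sub_im]; exact abs_im_le_norm _
  rcases (mem_frontier_box hw).1 hq with ⟨-, h | h⟩ | ⟨h | h, h'⟩
  · rw [h, sub_zero] at him
    exact (min_le_left _ _).trans ((min_le_left _ _).trans ((le_abs_self _).trans him))
  · rw [h] at him
    refine (min_le_left _ _).trans ((min_le_right _ _).trans (le_trans ?_ him))
    rw [abs_sub_comm]; exact le_abs_self _
  · rw [h, sub_zero] at hre
    exact (min_le_right _ _).trans ((le_abs_self _).trans hre)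
  · exact absurd ⟨h, h'⟩ hqA

/-- Distance from a point of the box to a frontier point off the BOTTOM side. [folklore] -/
theorem le_dist_of_mem_frontier_diff_bottom (hw : 0 < w) {p q : ℂ}
    (hq : q ∈ frontier (Ioo (0 : ℝ) w ×ℂ Ioo (0 : ℝ) 1) \ {z : ℂ | z.im = 0 ∧ z.re ∈ Icc (0 : ℝ) w}) :
    min (min p.re (w - p.re)) (1 - p.im) ≤ dist p q := by
  obtain ⟨hq, hqA⟩ := hq
  have hre := abs_re_sub_le_dist p q
  have him : |p.im - q.im| ≤ dist p q := by rw [dist_eq_norm, ← sub_im]; exact abs_im_le_norm _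
  rcases (mem_frontier_box hw).1 hq with ⟨h', h | h⟩ | ⟨h | h, -⟩
  · exact absurd ⟨h, h'⟩ hqA
  · rw [h] at him
    refine (min_le_right _ _).trans (le_trans ?_ him)
    rw [abs_sub_comm]; exact le_abs_self _
  · rw [h, sub_zero] at hre
    exact (min_le_left _ _).trans ((min_le_left _ _).trans ((le_abs_self _).trans hre))
  · rw [h] at hre
    refine (min_le_left _ _).trans ((min_le_right _ _).trans (le_trans ?_ hre))
    rw [abs_sub_comm]; exact le_abs_self _

/-- Distance from a point of the box to a frontier point off the TOP side. [folklore] -/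
theorem le_dist_of_mem_frontier_diff_top (hw : 0 < w) {p q : ℂ}
    (hq : q ∈ frontier (Ioo (0 : ℝ) w ×ℂ Ioo (0 : ℝ) 1) \ {z : ℂ | z.im = 1 ∧ z.re ∈ Icc (0 : ℝ) w}) :
    min (min p.re (w - p.re)) p.im ≤ dist p q := by
  obtain ⟨hq, hqA⟩ := hq
  have hre := abs_re_sub_le_dist p q
  have him : |p.im - q.im| ≤ dist p q := by rw [dist_eq_norm, ← sub_im]; exact abs_im_le_norm _
  rcases (mem_frontier_box hw).1 hq with ⟨h', h | h⟩ | ⟨h | h, -⟩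
  · rw [h, sub_zero] at him
    exact (min_le_right _ _).trans ((le_abs_self _).trans him)
  · exact absurd ⟨h, h'⟩ hqA
  · rw [h, sub_zero] at hre
    exact (min_le_left _ _).trans ((min_le_left _ _).trans ((le_abs_self _).trans hre))
  · rw [h] at hre
    refine (min_le_left _ _).trans ((min_le_right _ _).trans (le_trans ?_ hre))
    rw [abs_sub_comm]; exact le_abs_self _

/-! ## Rim sides inside the discrete arcs -/

/-- Integer-form membership gives membership in the discrete domain and in the mesh vertices.
[folklore] -/
theorem mem_of_bounds (hδ : 0 < δ) {a b : ℕ} (ha : δ * (a + 1) < w) (ha' : w ≤ δ * (a + 2))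
    (hb : δ * (b + 2) = 1) {v : Site 2} (h0 : 1 ≤ v 0) (h0' : v 0 ≤ a + 1) (h1 : 1 ≤ v 1)
    (h1' : v 1 ≤ b + 1) :
    v ∈ meshDomain (Ioo (0 : ℝ) w ×ℂ Ioo (0 : ℝ) 1) δ ∧
      v ∈ meshVertices (Ioo (0 : ℝ) w ×ℂ Ioo (0 : ℝ) 1) δ := by
  have hv : v ∈ meshVertices (Ioo (0 : ℝ) w ×ℂ Ioo (0 : ℝ) 1) δ :=
    (mem_meshVertices_box_iff hδ ha ha' hb).2 ⟨⟨h0, h0'⟩, h1, h1'⟩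
  exact ⟨by rwa [meshDomain_box hδ], hv⟩

/-- **The first column lies in the discrete arc of the LEFT side** (when `a ≥ 1`). [folklore] -/
theorem left_col_mem_arc (hδ : 0 < δ) {a b : ℕ} (ha : δ * (a + 1) < w) (ha' : w ≤ δ * (a + 2))
    (hb : δ * (b + 2) = 1) (h1a : 1 ≤ a) {v : Site 2} (hv0 : v 0 = 1) (h1 : 1 ≤ v 1)
    (h1' : v 1 ≤ b + 1) :
    v ∈ discreteArc (Ioo (0 : ℝ) w ×ℂ Ioo (0 : ℝ) 1) δ {z : ℂ | z.re = 0 ∧ z.im ∈ Icc (0 : ℝ) 1} := by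
  obtain ⟨hvD, hvV⟩ := mem_of_bounds hδ ha ha' hb (by omega) (by omega) h1 h1'
  obtain ⟨hw, ⟨e0, e1⟩, ⟨e2, e3⟩, hre, him⟩ := coords_of_mem hδ ha ha' hb hvV
  have h1a' : (1 : ℝ) ≤ a := by exact_mod_cast h1a
  have hv0' : (v 0 : ℝ) = 1 := by exact_mod_cast hv0
  refine ⟨⟨hvD, v - Pi.single 0 1, ?_, ?_⟩, ?_⟩
  · rw [zdGraph_adj_iff]; exact ⟨0, Or.inr (by simp)⟩
  · rw [discreteDomainGraph_adj_box hδ, mem_meshVertices_box_iff hδ ha ha' hb,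
      mem_meshVertices_box_iff hδ ha ha' hb]
    rintro ⟨-, -, ⟨h, -⟩, -⟩
    simp [hv0] at h
  · rw [show meshPoint δ v = ⟨δ * v 0, δ * v 1⟩ from Complex.ext (meshPoint_re δ v) (meshPoint_im δ v)]
    obtain ⟨hf, hd⟩ := foot_left hδ ha ha' hb hvV hv0
    have hle : infDist (⟨δ * v 0, δ * v 1⟩ : ℂ) {z : ℂ | z.re = 0 ∧ z.im ∈ Icc (0 : ℝ) 1} ≤ δ :=
      le_trans (infDist_le_dist_of_mem ⟨rfl, him⟩) hd
    refine hle.trans ?_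
    have hne : (frontier (Ioo (0 : ℝ) w ×ℂ Ioo (0 : ℝ) 1) \
        {z : ℂ | z.re = 0 ∧ z.im ∈ Icc (0 : ℝ) 1}).Nonempty :=
      ⟨⟨w, δ * v 1⟩, (feet_mem_frontier hw hre him).2.1, fun h => hw.ne' h.1⟩
    rw [le_infDist hne]
    intro q hq
    refine le_trans ?_ (le_dist_of_mem_frontier_diff_left hw hq)
    change δ ≤ min (min (δ * v 1) (1 - δ * v 1)) (w - δ * v 0)
    rw [hv0', mul_one]
    have : δ ≤ δ * a := by simpa using mul_le_mul_of_nonneg_left h1a' hδ.le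
    exact le_min (le_min e2 (by linarith)) (by linarith)

/-- **The last column lies in the discrete arc of the RIGHT side.** [folklore] -/
theorem right_col_mem_arc (hδ : 0 < δ) {a b : ℕ} (ha : δ * (a + 1) < w) (ha' : w ≤ δ * (a + 2))
    (hb : δ * (b + 2) = 1) {v : Site 2} (hv0 : v 0 = a + 1) (h1 : 1 ≤ v 1) (h1' : v 1 ≤ b + 1) :
    v ∈ discreteArc (Ioo (0 : ℝ) w ×ℂ Ioo (0 : ℝ) 1) δ {z : ℂ | z.re = w ∧ z.im ∈ Icc (0 : ℝ) 1} := by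
  obtain ⟨hvD, hvV⟩ := mem_of_bounds hδ ha ha' hb (by omega) (by omega) h1 h1'
  obtain ⟨hw, ⟨e0, e1⟩, ⟨e2, e3⟩, hre, him⟩ := coords_of_mem hδ ha ha' hb hvV
  have hv0' : (v 0 : ℝ) = a + 1 := by exact_mod_cast hv0
  refine ⟨⟨hvD, v + Pi.single 0 1, ?_, ?_⟩, ?_⟩
  · rw [zdGraph_adj_iff]; exact ⟨0, Or.inl rfl⟩
  · rw [discreteDomainGraph_adj_box hδ, mem_meshVertices_box_iff hδ ha ha' hb,
      mem_meshVertices_box_iff hδ ha ha' hb]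
    rintro ⟨-, -, ⟨-, h⟩, -⟩
    simp [hv0] at h
  · rw [show meshPoint δ v = ⟨δ * v 0, δ * v 1⟩ from Complex.ext (meshPoint_re δ v) (meshPoint_im δ v)]
    obtain ⟨hf, hd⟩ := foot_right hδ ha ha' hb hvV hv0
    have hle : infDist (⟨δ * v 0, δ * v 1⟩ : ℂ) {z : ℂ | z.re = w ∧ z.im ∈ Icc (0 : ℝ) 1} ≤
        w - δ * (a + 1) := by
      refine le_trans (infDist_le_dist_of_mem (y := ⟨w, δ * v 1⟩) ⟨rfl, him⟩) ?_
      rw [dist_mk_re, hv0', abs_le]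
      constructor <;> linarith
    refine hle.trans ?_
    have hne : (frontier (Ioo (0 : ℝ) w ×ℂ Ioo (0 : ℝ) 1) \
        {z : ℂ | z.re = w ∧ z.im ∈ Icc (0 : ℝ) 1}).Nonempty :=
      ⟨⟨0, δ * v 1⟩, (feet_mem_frontier hw hre him).1, fun h => hw.ne h.1⟩
    rw [le_infDist hne]
    intro q hq
    refine le_trans ?_ (le_dist_of_mem_frontier_diff_right hw hq)
    change w - δ * (a + 1) ≤ min (min (δ * v 1) (1 - δ * v 1)) (δ * v 0)
    rw [hv0']
    refine le_min (le_min (by linarith) (by linarith)) ?_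
    have : (0 : ℝ) ≤ δ * (a + 1) := by positivity
    linarith

/-- **The first row, minus its last site, lies in the discrete arc of the BOTTOM side.**
[folklore] -/
theorem bottom_row_mem_arc (hδ : 0 < δ) {a b : ℕ} (ha : δ * (a + 1) < w) (ha' : w ≤ δ * (a + 2))
    (hb : δ * (b + 2) = 1) {v : Site 2} (hv1 : v 1 = 1) (h0 : 1 ≤ v 0) (h0' : v 0 ≤ a) :
    v ∈ discreteArc (Ioo (0 : ℝ) w ×ℂ Ioo (0 : ℝ) 1) δ {z : ℂ | z.im = 0 ∧ z.re ∈ Icc (0 : ℝ) w} := by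
  obtain ⟨hvD, hvV⟩ := mem_of_bounds hδ ha ha' hb h0 (by omega) (by omega) (by omega)
  obtain ⟨hw, ⟨e0, e1⟩, ⟨e2, e3⟩, hre, him⟩ := coords_of_mem hδ ha ha' hb hvV
  have hv1' : (v 1 : ℝ) = 1 := by exact_mod_cast hv1
  have h0r : (v 0 : ℝ) ≤ a := by exact_mod_cast h0'
  have h0r' : δ * v 0 ≤ δ * a := mul_le_mul_of_nonneg_left h0r hδ.le
  refine ⟨⟨hvD, v - Pi.single 1 1, ?_, ?_⟩, ?_⟩
  · rw [zdGraph_adj_iff]; exact ⟨1, Or.inr (by simp)⟩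
  · rw [discreteDomainGraph_adj_box hδ, mem_meshVertices_box_iff hδ ha ha' hb,
      mem_meshVertices_box_iff hδ ha ha' hb]
    rintro ⟨-, -, -, h, -⟩
    simp [hv1] at h
  · rw [show meshPoint δ v = ⟨δ * v 0, δ * v 1⟩ from Complex.ext (meshPoint_re δ v) (meshPoint_im δ v)]
    obtain ⟨hf, hd⟩ := foot_bottom hδ ha ha' hb hvV hv1
    have hle : infDist (⟨δ * v 0, δ * v 1⟩ : ℂ) {z : ℂ | z.im = 0 ∧ z.re ∈ Icc (0 : ℝ) w} ≤ δ :=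
      le_trans (infDist_le_dist_of_mem ⟨rfl, hre⟩) hd
    refine hle.trans ?_
    have hne : (frontier (Ioo (0 : ℝ) w ×ℂ Ioo (0 : ℝ) 1) \
        {z : ℂ | z.im = 0 ∧ z.re ∈ Icc (0 : ℝ) w}).Nonempty :=
      ⟨⟨δ * v 0, 1⟩, (feet_mem_frontier hw hre him).2.2.2, fun h => one_ne_zero h.1⟩
    rw [le_infDist hne]
    intro q hq
    refine le_trans ?_ (le_dist_of_mem_frontier_diff_bottom hw hq)
    change δ ≤ min (min (δ * v 0) (w - δ * v 0)) (1 - δ * v 1)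
    rw [hv1', mul_one]
    refine le_min (le_min e0 (by linarith)) ?_
    have : (0 : ℝ) ≤ δ * b := by positivity
    linarith

/-- **The last row, minus its last site, lies in the discrete arc of the TOP side.** [folklore] -/
theorem top_row_mem_arc (hδ : 0 < δ) {a b : ℕ} (ha : δ * (a + 1) < w) (ha' : w ≤ δ * (a + 2))
    (hb : δ * (b + 2) = 1) {v : Site 2} (hv1 : v 1 = b + 1) (h0 : 1 ≤ v 0) (h0' : v 0 ≤ a) :
    v ∈ discreteArc (Ioo (0 : ℝ) w ×ℂ Ioo (0 : ℝ) 1) δ {z : ℂ | z.im = 1 ∧ z.re ∈ Icc (0 : ℝ) w} := by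
  obtain ⟨hvD, hvV⟩ := mem_of_bounds hδ ha ha' hb h0 (by omega) (by omega) (by omega)
  obtain ⟨hw, ⟨e0, e1⟩, ⟨e2, e3⟩, hre, him⟩ := coords_of_mem hδ ha ha' hb hvV
  have hv1' : (v 1 : ℝ) = b + 1 := by exact_mod_cast hv1
  have h0r : (v 0 : ℝ) ≤ a := by exact_mod_cast h0'
  have h0r' : δ * v 0 ≤ δ * a := mul_le_mul_of_nonneg_left h0r hδ.le
  refine ⟨⟨hvD, v + Pi.single 1 1, ?_, ?_⟩, ?_⟩
  · rw [zdGraph_adj_iff]; exact ⟨1, Or.inl rfl⟩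
  · rw [discreteDomainGraph_adj_box hδ, mem_meshVertices_box_iff hδ ha ha' hb,
      mem_meshVertices_box_iff hδ ha ha' hb]
    rintro ⟨-, -, -, -, h⟩
    simp [hv1] at h
  · rw [show meshPoint δ v = ⟨δ * v 0, δ * v 1⟩ from Complex.ext (meshPoint_re δ v) (meshPoint_im δ v)]
    obtain ⟨hf, hd⟩ := foot_top hδ ha ha' hb hvV hv1
    have hle : infDist (⟨δ * v 0, δ * v 1⟩ : ℂ) {z : ℂ | z.im = 1 ∧ z.re ∈ Icc (0 : ℝ) w} ≤
        1 - δ * (b + 1) := by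
      refine le_trans (infDist_le_dist_of_mem (y := ⟨δ * v 0, 1⟩) ⟨rfl, hre⟩) ?_
      rw [dist_mk_im, hv1', abs_le]
      constructor <;> linarith
    refine hle.trans ?_
    have hne : (frontier (Ioo (0 : ℝ) w ×ℂ Ioo (0 : ℝ) 1) \
        {z : ℂ | z.im = 1 ∧ z.re ∈ Icc (0 : ℝ) w}).Nonempty :=
      ⟨⟨δ * v 0, 0⟩, (feet_mem_frontier hw hre him).2.2.1, fun h => zero_ne_one h.1⟩
    rw [le_infDist hne]
    intro q hq
    refine le_trans ?_ (le_dist_of_mem_frontier_diff_top hw hq)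
    change 1 - δ * (b + 1) ≤ min (min (δ * v 0) (w - δ * v 0)) (δ * v 1)
    rw [hv1']
    refine le_min (le_min (by linarith) (by linarith)) ?_
    have : (0 : ℝ) ≤ δ * (b + 1) := by positivity
    linarith

/-! ## Open paths of `Ω_δ` versus open lattice paths in the lattice box -/

/-- An open path of `Ω_δ` is an open lattice path inside the lattice box. [folklore] -/
theorem openConnIn_of_reachable (hδ : 0 < δ) {ω : BondConfig (Site 2)} {x y : Site 2}
    (hx : x ∈ meshVertices (Ioo (0 : ℝ) w ×ℂ Ioo (0 : ℝ) 1) δ)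
    (h : (openGraph ω ⊓ discreteDomainGraph (Ioo (0 : ℝ) w ×ℂ Ioo (0 : ℝ) 1) δ).Reachable x y) :
    ω ∈ openConnIn (meshVertices (Ioo (0 : ℝ) w ×ℂ Ioo (0 : ℝ) 1) δ) x y := by
  obtain ⟨W⟩ := h
  induction W with
  | nil => exact openConnIn_refl hx
  | @cons a' b' c' hab W ih =>
    obtain ⟨hω, -, ha, hb⟩ := (open_inf_adj_box hδ).1 hab
    exact PlanarDuality.openConnIn_trans (openConnIn_of_adj ha hb hω hab.ne) (ih hb)

/-- **An open lattice path inside the lattice box is an open path of `Ω_δ`** (for a lattice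
configuration `ω ⊆ E(ℤ²)`). [folklore] -/
theorem reachable_of_openConnIn (hδ : 0 < δ) {ω : BondConfig (Site 2)}
    (hωE : ω ⊆ (zdGraph 2).edgeSet) {x y : Site 2}
    (h : ω ∈ openConnIn (meshVertices (Ioo (0 : ℝ) w ×ℂ Ioo (0 : ℝ) 1) δ) x y) :
    (openGraph ω ⊓ discreteDomainGraph (Ioo (0 : ℝ) w ×ℂ Ioo (0 : ℝ) 1) δ).Reachable x y := by
  obtain ⟨hx, hy, ⟨W⟩⟩ := h
  set V := meshVertices (Ioo (0 : ℝ) w ×ℂ Ioo (0 : ℝ) 1) δ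
  suffices H' : ∀ (p q : V) (W : ((openGraph ω).induce V).Walk p q),
      (openGraph ω ⊓ discreteDomainGraph (Ioo (0 : ℝ) w ×ℂ Ioo (0 : ℝ) 1) δ).Reachable p q from
    H' _ _ W
  intro p q W
  induction W with
  | nil => exact SimpleGraph.Reachable.refl _
  | @cons p q r hpq W ih =>
    have hpq' : (openGraph ω).Adj p q := hpq
    obtain ⟨hmem, hne⟩ := (openGraph_adj _ _ _).1 hpq'
    have hzd : (zdGraph 2).Adj p q := by
      have := hωE hmem
      rwa [SimpleGraph.mem_edgeSet] at this
    refine (SimpleGraph.Adj.reachable ?_).trans ih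
    exact (open_inf_adj_box hδ).2 ⟨hmem, hzd, p.2, q.2⟩

/-! ## Shifted lattice rectangles -/

/-- Membership in the shifted rectangle `(1,1) + [0, a] × [0, b]`. [folklore] -/
theorem mem_shift_rectangle {a b : ℕ} {v : Site 2} :
    v ∈ (· + (![1, 1] : Site 2)) '' (↑(rectangle a b) : Set (Site 2)) ↔
      (1 ≤ v 0 ∧ v 0 ≤ a + 1) ∧ (1 ≤ v 1 ∧ v 1 ≤ b + 1) := by
  rw [Set.image_add_right, Set.mem_preimage]
  simp only [Finset.mem_coe, mem_rectangle_iff, Pi.add_apply, Pi.neg_apply, Matrix.cons_val_zero,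
    Matrix.cons_val_one]
  omega

/-- Membership in the shifted left side. [folklore] -/
theorem mem_shift_leftSide {a b : ℕ} {v : Site 2} :
    v ∈ (· + (![1, 1] : Site 2)) '' (↑(leftSide a b) : Set (Site 2)) ↔
      v 0 = 1 ∧ (1 ≤ v 1 ∧ v 1 ≤ b + 1) := by
  rw [Set.image_add_right, Set.mem_preimage]
  simp only [Finset.mem_coe, leftSide, Finset.mem_filter, mem_rectangle_iff, Pi.add_apply,
    Pi.neg_apply, Matrix.cons_val_zero, Matrix.cons_val_one]
  omega

/-- Membership in the shifted right side. [folklore] -/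
theorem mem_shift_rightSide {a b : ℕ} {v : Site 2} :
    v ∈ (· + (![1, 1] : Site 2)) '' (↑(rightSide a b) : Set (Site 2)) ↔
      v 0 = a + 1 ∧ (1 ≤ v 1 ∧ v 1 ≤ b + 1) := by
  rw [Set.image_add_right, Set.mem_preimage]
  simp only [Finset.mem_coe, rightSide, Finset.mem_filter, mem_rectangle_iff, Pi.add_apply,
    Pi.neg_apply, Matrix.cons_val_zero, Matrix.cons_val_one]
  omega

/-- Membership in the shifted bottom side. [folklore] -/
theorem mem_shift_bottomSide {a b : ℕ} {v : Site 2} :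
    v ∈ (· + (![1, 1] : Site 2)) '' (↑(bottomSide a b) : Set (Site 2)) ↔
      v 1 = 1 ∧ (1 ≤ v 0 ∧ v 0 ≤ a + 1) := by
  rw [Set.image_add_right, Set.mem_preimage]
  simp only [Finset.mem_coe, bottomSide, Finset.mem_filter, mem_rectangle_iff, Pi.add_apply,
    Pi.neg_apply, Matrix.cons_val_zero, Matrix.cons_val_one]
  omega

/-- Membership in the shifted top side. [folklore] -/
theorem mem_shift_topSide {a b : ℕ} {v : Site 2} :
    v ∈ (· + (![1, 1] : Site 2)) '' (↑(topSide a b) : Set (Site 2)) ↔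
      v 1 = b + 1 ∧ (1 ≤ v 0 ∧ v 0 ≤ a + 1) := by
  rw [Set.image_add_right, Set.mem_preimage]
  simp only [Finset.mem_coe, topSide, Finset.mem_filter, mem_rectangle_iff, Pi.add_apply,
    Pi.neg_apply, Matrix.cons_val_zero, Matrix.cons_val_one]
  omega

/-- The shifted rectangle `(1,1) + [0, a] × [0, b]` is the set of mesh vertices of the box.
[folklore] -/
theorem shift_rectangle_eq_meshVertices (hδ : 0 < δ) {a b : ℕ} (ha : δ * (a + 1) < w)
    (ha' : w ≤ δ * (a + 2)) (hb : δ * (b + 2) = 1) :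
    (· + (![1, 1] : Site 2)) '' (↑(rectangle a b) : Set (Site 2)) =
      meshVertices (Ioo (0 : ℝ) w ×ℂ Ioo (0 : ℝ) 1) δ := by
  ext v
  rw [mem_shift_rectangle, mem_meshVertices_box_iff hδ ha ha' hb]

end RectangleDuality

/-- Registered stub of this support file (part 3 of the rectangle duality): the first column lies
in the discrete arc of the left side. [folklore] -/
theorem stub_rectangleDuality_leftCol :
    ∀ (w δ : ℝ) (a b : ℕ), 0 < δ → δ * (a + 1) < w → w ≤ δ * (a + 2) → δ * (b + 2) = 1 → 1 ≤ a →
      ∀ v : Site 2, v 0 = 1 → 1 ≤ v 1 → v 1 ≤ b + 1 →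
        v ∈ discreteArc (Ioo (0 : ℝ) w ×ℂ Ioo (0 : ℝ) 1) δ {z : ℂ | z.re = 0 ∧ z.im ∈ Icc (0 : ℝ) 1} :=
  fun _ _ _ _ hδ ha ha' hb h1a _ hv0 h1 h1' =>
    RectangleDuality.left_col_mem_arc hδ ha ha' hb h1a hv0 h1 h1'

end Summit.CriticalPhenomena.CardyFormulaZ2.Cruxes.SimilarityUpgrade.Stubs

end
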